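import Mathlib
import HarnessLib
import Summits.QuantumFields.YangMills.Theorems.PencilRigidityPlanarToEuclideanSO4
import Summits.QuantumFields.YangMills.Theorems.NPointIsotropy.Negative.HyperoctahedralPlane
import Literature.MathematicalPhysics.QuantumFieldTheory.OSLorentzInvariance

/-!
# `SO(4)` from the proper signed permutations, the Σ5 rotation and closedness (Niven)

Support file (pure Euclidean geometry + Niven's theorem; sub-goal `so4_of_cubic_of_sigma5` of stub
`stub_upgrade`, crux `OSLegsFromFemtoAndGap` stmt-QuantumFields-9367, line `dlr-collar-transfer`; it is the
group-theoretic content of the route items `CoincidenceRotationBootstrap.EuclideanUpgrade` (8647) and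
`DensityLemma` (8648)). `E4` is the tree's abbreviation `NPointIsotropy.Negative.E4 = EuclideanSpace ℝ (Fin 4)`;
`ρ t` abbreviates (in the docstrings only) the tree's rotation `planeRot (d := 3) 0 t` by the angle `t` of the
`(x₀,x₁)`-plane (`e₀ ↦ cos t e₀ - sin t e₁`, `e₁ ↦ sin t e₀ + cos t e₁`, `e₂, e₃` fixed).

**Main theorem** `so4_of_cubic_of_sigma5` (stated over Mathlib vocabulary only): a predicate `P` on
`ℝ⁴ ≃ₗᵢ[ℝ] ℝ⁴` closed under composition and inverses, holding at the identity, such that the set of angles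
`t` for which `P` holds on the `(x₀,x₁)`-rotation by `t` is closed, holding on every proper signed permutation
(determinant one, axes to `±` axes) and on the Σ5 rotation (`e₀, e₁` fixed, `e₂ ↦ (3e₂+4e₃)/5`,
`e₃ ↦ (-4e₂+3e₃)/5`), holds on every determinant-one linear isometry of `ℝ⁴`.

Proof:
* `ρ` is a one-parameter group (`rho_add`, `rho_zero`, `rho_symm`) of determinant one (`det_rho`: the
  determinant of an isometry is `±1`, Mathlib `OrthonormalBasis.det_to_matrix_orthonormalBasis_real`, and
  `ρ t = ρ (t/2) ∘ ρ (t/2)`), so `H = {t | P (ρ t)}` is a closed additive subgroup of `ℝ`;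
* `π/2 ∈ H` because `ρ (π/2)` is a proper signed permutation; conjugating `ρ θ` (`cos θ = 3/5`,
  `sin θ = -4/5`) by the proper signed permutation `Q_B : e₀ ↔ e₂, e₁ ↔ e₃` (`QB_spec` of
  `PencilRigidityPlanarToEuclideanSO4`) gives exactly the Σ5 rotation, so `θ ∈ H` (`rho_of_conj`);
* Mathlib `AddSubgroup.dense_or_cyclic`: if `H` were cyclic, `θ` would be a rational multiple of `π` with
  `cos θ = 3/5 ∉ {0, ±1/2, ±1}`, contradicting Niven's theorem (Mathlib `niven`); so `H` is dense, and
  closed, hence `H = ℝ` (`rho_all_of_closed`);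
* a determinant-one isometry `A` fixing `e₂, e₃` has `A e₀ = (cos φ, -sin φ, 0, 0) = ρ φ e₀`, and
  `(ρ φ)⁻¹ ∘ A` fixes `e₀, e₂, e₃` and maps `e₁` to `±e₁`: a proper signed permutation, so `P A`
  (`planar_of_rho`); the tree's Givens generation `PlanarToEuclidean.so4_generation` finishes.

References: I. Niven, Irrational Numbers (1956), Cor. 3.12; folklore (Givens rotations, closed subgroups
of `ℝ`). No definitions, no notation.
-/

noncomputable section

namespace Summit.QuantumFields.YangMills.Theorems.OSLegsFromFemtoAndGap.Upgrade

open Literature.MathematicalPhysics.QuantumFieldTheory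
open Summit.QuantumFields.YangMills.Theorems.PlanarToEuclidean
open Summit.QuantumFields.YangMills.Theorems.NPointIsotropy.Negative (E4)

/-! ### The one-parameter group of `(x₀,x₁)`-plane rotations -/

/-- `ρ t e₀ = cos t • e₀ - sin t • e₁`. [folklore] -/
theorem rho_e0 (t : ℝ) :
    (planeRot (d := 3) 0 t) (EuclideanSpace.single 0 1 : E4) =
      Real.cos t • (EuclideanSpace.single 0 1 : E4) + (-Real.sin t) • (EuclideanSpace.single 1 1 : E4) := by
  ext j; fin_cases j <;> simp

/-- `ρ t e₁ = sin t • e₀ + cos t • e₁`. [folklore] -/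
theorem rho_e1 (t : ℝ) :
    (planeRot (d := 3) 0 t) (EuclideanSpace.single 1 1 : E4) =
      Real.sin t • (EuclideanSpace.single 0 1 : E4) + Real.cos t • (EuclideanSpace.single 1 1 : E4) := by
  ext j; fin_cases j <;> simp

/-- `ρ t` fixes `e₂`. [folklore] -/
theorem rho_e2 (t : ℝ) :
    (planeRot (d := 3) 0 t) (EuclideanSpace.single 2 1 : E4) = (EuclideanSpace.single 2 1 : E4) := by
  ext j; fin_cases j <;> simp

/-- `ρ t` fixes `e₃`. [folklore] -/
theorem rho_e3 (t : ℝ) :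
    (planeRot (d := 3) 0 t) (EuclideanSpace.single 3 1 : E4) = (EuclideanSpace.single 3 1 : E4) := by
  ext j; fin_cases j <;> simp

/-- `ρ (π/2) e₀ = -e₁`. [folklore] -/
theorem rho_pi_div_two_e0 :
    (planeRot (d := 3) 0 (Real.pi / 2)) (EuclideanSpace.single 0 1 : E4) =
      -(EuclideanSpace.single 1 1 : E4) := by
  rw [rho_e0, Real.cos_pi_div_two, Real.sin_pi_div_two]; simp

/-- `ρ (π/2) e₁ = e₀`. [folklore] -/
theorem rho_pi_div_two_e1 :
    (planeRot (d := 3) 0 (Real.pi / 2)) (EuclideanSpace.single 1 1 : E4) =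
      (EuclideanSpace.single 0 1 : E4) := by
  rw [rho_e1, Real.cos_pi_div_two, Real.sin_pi_div_two]; simp

/-- **Group law** `ρ (s + t) = ρ t ∘ ρ s`. [folklore] -/
theorem rho_add (s t : ℝ) :
    planeRot (d := 3) 0 (s + t) = (planeRot (d := 3) 0 s).trans (planeRot (d := 3) 0 t) := by
  ext x j
  fin_cases j <;> simp [Real.cos_add, Real.sin_add] <;> ring

/-- `ρ 0 = 1`. [folklore] -/
theorem rho_zero : planeRot (d := 3) 0 0 = LinearIsometryEquiv.refl ℝ _ :=
  LinearIsometryEquiv.ext fun x => planeRot_zero_apply (d := 3) 0 x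

/-- `(ρ t)⁻¹ = ρ (-t)` (pointwise). [folklore] -/
theorem rho_symm_apply (t : ℝ) (y : E4) : (planeRot (d := 3) 0 t).symm y = planeRot (d := 3) 0 (-t) y := by
  apply (planeRot (d := 3) 0 t).injective
  rw [LinearIsometryEquiv.apply_symm_apply]
  have h := planeRotLin_neg_apply_planeRotLin (d := 3) 0 (-t) y
  rw [neg_neg] at h
  exact h.symm

/-- `(ρ t)⁻¹ = ρ (-t)`. [folklore] -/
theorem rho_symm (t : ℝ) : (planeRot (d := 3) 0 t).symm = planeRot (d := 3) 0 (-t) :=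
  LinearIsometryEquiv.ext fun x => rho_symm_apply t x

/-- A linear isometry acting on the axis vectors as `ρ t` is `ρ t`. [folklore] -/
theorem eq_rho_of_apply_single (A : E4 ≃ₗᵢ[ℝ] E4) (t : ℝ)
    (h0 : A (EuclideanSpace.single 0 1) =
      Real.cos t • EuclideanSpace.single 0 1 + (-Real.sin t) • EuclideanSpace.single 1 1)
    (h1 : A (EuclideanSpace.single 1 1) =
      Real.sin t • EuclideanSpace.single 0 1 + Real.cos t • EuclideanSpace.single 1 1)
    (h2 : A (EuclideanSpace.single 2 1) = EuclideanSpace.single 2 1)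
    (h3 : A (EuclideanSpace.single 3 1) = EuclideanSpace.single 3 1) : A = planeRot (d := 3) 0 t := by
  have hlin : (A.toLinearEquiv : E4 →ₗ[ℝ] E4) = ((planeRot (d := 3) 0 t).toLinearEquiv : E4 →ₗ[ℝ] E4) := by
    refine (EuclideanSpace.basisFun (Fin 4) ℝ).toBasis.ext fun i => ?_
    simp only [OrthonormalBasis.coe_toBasis, EuclideanSpace.basisFun_apply, LinearEquiv.coe_coe,
      LinearIsometryEquiv.coe_toLinearEquiv]
    fin_cases i
    exacts [h0.trans (rho_e0 t).symm, h1.trans (rho_e1 t).symm, h2.trans (rho_e2 t).symm,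
      h3.trans (rho_e3 t).symm]
  ext x : 1
  exact LinearMap.congr_fun hlin x

/-- **The determinant of a linear isometry of `ℝ⁴` is `±1`** (its matrix in the standard orthonormal basis
is orthogonal). [folklore] -/
theorem det_eq_one_or_eq_neg_one (R : E4 ≃ₗᵢ[ℝ] E4) :
    LinearMap.det (R.toLinearEquiv : E4 →ₗ[ℝ] E4) = 1 ∨
      LinearMap.det (R.toLinearEquiv : E4 →ₗ[ℝ] E4) = -1 := by
  set a : OrthonormalBasis (Fin 4) ℝ E4 := EuclideanSpace.basisFun (Fin 4) ℝ with ha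
  have h := a.det_to_matrix_orthonormalBasis_real (a.map R)
  have hb : (⇑(a.map R) : Fin 4 → E4) = ⇑(R.toLinearEquiv : E4 →ₗ[ℝ] E4) ∘ ⇑a.toBasis := by
    funext i
    simp only [OrthonormalBasis.map_apply, Function.comp_apply, OrthonormalBasis.coe_toBasis,
      LinearEquiv.coe_coe, LinearIsometryEquiv.coe_toLinearEquiv]
  rwa [hb, Module.Basis.det_comp, Module.Basis.det_self, mul_one] at h

/-- **`ρ t ∈ SO(4)`**: `det (ρ t) = det (ρ (t/2))² = (±1)² = 1`. [folklore] -/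
theorem det_rho (t : ℝ) :
    LinearMap.det ((planeRot (d := 3) 0 t).toLinearEquiv : E4 →ₗ[ℝ] E4) = 1 := by
  have h : planeRot (d := 3) 0 t = (planeRot (d := 3) 0 (t / 2)).trans (planeRot (d := 3) 0 (t / 2)) := by
    rw [← rho_add, add_halves]
  rw [h, det_trans]
  rcases det_eq_one_or_eq_neg_one (planeRot (d := 3) 0 (t / 2)) with h1 | h1 <;> rw [h1] <;> norm_num

/-- A point of the unit circle is `(cos φ, -sin φ)` (via `Complex.arg` of `a - b i`). [folklore] -/
theorem exists_cos_eq_and_sin_eq_neg {a b : ℝ} (h : a ^ 2 + b ^ 2 = 1) :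
    ∃ φ : ℝ, Real.cos φ = a ∧ Real.sin φ = -b := by
  set z : ℂ := ⟨a, -b⟩ with hz
  have hzn : ‖z‖ = 1 := by
    rw [Complex.norm_def, Complex.normSq_mk, ← sq, ← sq, neg_sq, h, Real.sqrt_one]
  have hz0 : z ≠ 0 := by
    intro h0
    rw [h0, norm_zero] at hzn
    exact zero_ne_one hzn
  exact ⟨Complex.arg z, by rw [Complex.cos_arg hz0, hzn, div_one], by rw [Complex.sin_arg, hzn, div_one]⟩

/-! ### Generation -/

section Generation

variable (P : (E4 ≃ₗᵢ[ℝ] E4) → Prop)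

/-- **All plane rotations from two**: if `P` is closed under composition and inverses, holds at the identity,
`{t | P (ρ t)}` is closed, and `P` holds at `ρ (π/2)` and at some `ρ θ` with `cos θ = 3/5`, then `P (ρ t)` for
every `t` — the angle set is a closed additive subgroup of `ℝ`, not cyclic by Niven's theorem, hence dense,
hence everything. [cite: Niven1956, Cor. 3.12] -/
theorem rho_all_of_closed (hmul : ∀ A B, P A → P B → P (A.trans B)) (hinv : ∀ A, P A → P A.symm)
    (hone : P (LinearIsometryEquiv.refl ℝ E4)) (hclosed : IsClosed {t : ℝ | P (planeRot (d := 3) 0 t)})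
    (hpi : P (planeRot (d := 3) 0 (Real.pi / 2)))
    (hθ : ∃ θ : ℝ, Real.cos θ = 3 / 5 ∧ P (planeRot (d := 3) 0 θ)) (t : ℝ) :
    P (planeRot (d := 3) 0 t) := by
  let H : AddSubgroup ℝ :=
    { carrier := {t : ℝ | P (planeRot (d := 3) 0 t)}
      zero_mem' := by
        show P (planeRot (d := 3) 0 0)
        rw [rho_zero]
        exact hone
      add_mem' := fun {a b} ha hb => by
        show P (planeRot (d := 3) 0 (a + b))
        rw [rho_add]
        exact hmul _ _ ha hb
      neg_mem' := fun {a} ha => by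
        show P (planeRot (d := 3) 0 (-a))
        rw [← rho_symm]
        exact hinv _ ha }
  obtain ⟨θ, hcos, hPθ⟩ := hθ
  have hH : (H : Set ℝ) = Set.univ := by
    rcases AddSubgroup.dense_or_cyclic H with hd | ⟨a, ha⟩
    · have hc : IsClosed (H : Set ℝ) := hclosed
      rw [← hc.closure_eq, hd.closure_eq]
    · exfalso
      have hpi' : (Real.pi / 2 : ℝ) ∈ H := hpi
      have hθ' : θ ∈ H := hPθ
      rw [ha, AddSubgroup.mem_closure_singleton] at hpi' hθ'
      obtain ⟨m, hm⟩ := hpi'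
      obtain ⟨k, hk⟩ := hθ'
      rw [zsmul_eq_mul] at hm hk
      have hm0 : (m : ℝ) ≠ 0 := by
        rintro h0
        rw [h0, zero_mul] at hm
        linarith [Real.pi_pos]
      have hθq : θ = ((k / (2 * m) : ℚ) : ℝ) * Real.pi := by
        push_cast
        rw [div_mul_eq_mul_div, eq_div_iff (mul_ne_zero two_ne_zero hm0)]
        linear_combination (-2 * (m : ℝ)) * hk + 2 * (k : ℝ) * hm
      have h1 : Real.cos θ ∈ ({-1, -1 / 2, 0, 1 / 2, 1} : Set ℝ) :=
        niven ⟨k / (2 * m), hθq⟩ ⟨3 / 5, by rw [hcos]; push_cast; ring⟩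
      rw [hcos] at h1
      simp only [Set.mem_insert_iff, Set.mem_singleton_iff] at h1
      norm_num at h1
  exact (hH ▸ Set.mem_univ t : t ∈ (H : Set ℝ))

/-- **Conjugating a `(x₀,x₁)`-rotation into the Σ5 rotation**: if `P` is closed under composition and
inverses, holds on the Σ5 rotation (`e₀, e₁` fixed, `e₂ ↦ (3e₂+4e₃)/5`, `e₃ ↦ (-4e₂+3e₃)/5`) and on an
isometry `Q : e₀ ↦ e₂, e₁ ↦ e₃, e₂ ↦ e₀, e₃ ↦ e₁`, then `P (ρ θ)` whenever `cos θ = 3/5`, `sin θ = -4/5`: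
`Q⁻¹ ∘ ρ θ ∘ Q` is the Σ5 rotation. [folklore] -/
theorem rho_of_conj (hmul : ∀ A B, P A → P B → P (A.trans B)) (hinv : ∀ A, P A → P A.symm)
    (hsigma : ∀ R : E4 ≃ₗᵢ[ℝ] E4, (R (EuclideanSpace.single 0 1) = EuclideanSpace.single 0 1 ∧
      R (EuclideanSpace.single 1 1) = EuclideanSpace.single 1 1 ∧
      R (EuclideanSpace.single 2 1) =
        (3 / 5 : ℝ) • EuclideanSpace.single 2 1 + (4 / 5 : ℝ) • EuclideanSpace.single 3 1 ∧
      R (EuclideanSpace.single 3 1) =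
        -((4 / 5 : ℝ) • EuclideanSpace.single 2 1) + (3 / 5 : ℝ) • EuclideanSpace.single 3 1) → P R)
    {θ : ℝ} (hc : Real.cos θ = 3 / 5) (hs : Real.sin θ = -(4 / 5)) (Q : E4 ≃ₗᵢ[ℝ] E4) (hPQ : P Q)
    (hQ0 : Q (EuclideanSpace.single 0 1) = EuclideanSpace.single 2 1)
    (hQ1 : Q (EuclideanSpace.single 1 1) = EuclideanSpace.single 3 1)
    (hQ2 : Q (EuclideanSpace.single 2 1) = EuclideanSpace.single 0 1)
    (hQ3 : Q (EuclideanSpace.single 3 1) = EuclideanSpace.single 1 1) :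
    P (planeRot (d := 3) 0 θ) := by
  have hQs0 : Q.symm (EuclideanSpace.single 0 1) = EuclideanSpace.single 2 1 := by
    rw [← hQ2, LinearIsometryEquiv.symm_apply_apply]
  have hQs1 : Q.symm (EuclideanSpace.single 1 1) = EuclideanSpace.single 3 1 := by
    rw [← hQ3, LinearIsometryEquiv.symm_apply_apply]
  have hQs2 : Q.symm (EuclideanSpace.single 2 1) = EuclideanSpace.single 0 1 := by
    rw [← hQ0, LinearIsometryEquiv.symm_apply_apply]
  have hQs3 : Q.symm (EuclideanSpace.single 3 1) = EuclideanSpace.single 1 1 := by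
    rw [← hQ1, LinearIsometryEquiv.symm_apply_apply]
  set R : E4 ≃ₗᵢ[ℝ] E4 := Q.trans ((planeRot (d := 3) 0 θ).trans Q.symm) with hR
  have hPR : P R := by
    refine hsigma R ⟨?_, ?_, ?_, ?_⟩
    · rw [hR, LinearIsometryEquiv.trans_apply, LinearIsometryEquiv.trans_apply, hQ0, rho_e2, hQs2]
    · rw [hR, LinearIsometryEquiv.trans_apply, LinearIsometryEquiv.trans_apply, hQ1, rho_e3, hQs3]
    · rw [hR, LinearIsometryEquiv.trans_apply, LinearIsometryEquiv.trans_apply, hQ2, rho_e0, map_add,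
        map_smul, map_smul, hQs0, hQs1, hc, hs, neg_neg]
    · rw [hR, LinearIsometryEquiv.trans_apply, LinearIsometryEquiv.trans_apply, hQ3, rho_e1, map_add,
        map_smul, map_smul, hQs0, hQs1, hc, hs, neg_smul]
  have hρ : planeRot (d := 3) 0 θ = Q.symm.trans (R.trans Q) := by
    ext x : 1
    simp [hR]
  rw [hρ]
  exact hmul _ _ (hinv _ hPQ) (hmul _ _ hPR hPQ)

/-- **The determinant-one stabiliser of `e₂, e₃` from the rotations and the proper signed permutations**:
if `P` is closed under composition, holds on the proper signed permutations and on every `ρ t`, then `P A`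
for every determinant-one isometry `A` fixing `e₂, e₃` — `A e₀ = (cos φ, -sin φ, 0, 0) = ρ φ e₀` for some
`φ`, and `B = A` followed by `(ρ φ)⁻¹` fixes `e₀, e₂, e₃`, so maps `e₁` to `±e₁`. [folklore] -/
theorem planar_of_rho (hmul : ∀ A B, P A → P B → P (A.trans B))
    (hhyper : ∀ A : E4 ≃ₗᵢ[ℝ] E4, LinearMap.det (A.toLinearEquiv : E4 →ₗ[ℝ] E4) = 1 →
      (∀ i : Fin 4, ∃ j : Fin 4, A (EuclideanSpace.single i 1) = EuclideanSpace.single j 1 ∨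
        A (EuclideanSpace.single i 1) = -EuclideanSpace.single j 1) → P A)
    (hrho : ∀ t : ℝ, P (planeRot (d := 3) 0 t)) (A : E4 ≃ₗᵢ[ℝ] E4)
    (hA : LinearMap.det (A.toLinearEquiv : E4 →ₗ[ℝ] E4) = 1)
    (h2 : A (EuclideanSpace.single 2 1) = EuclideanSpace.single 2 1)
    (h3 : A (EuclideanSpace.single 3 1) = EuclideanSpace.single 3 1) : P A := by
  -- `u = A e₀` lies on the unit circle of the `(x₀,x₁)`-plane
  set u : E4 := A (EuclideanSpace.single 0 1) with hu
  have hu2 : u 2 = 0 := by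
    have h := A.inner_map_map (EuclideanSpace.single 0 1) (EuclideanSpace.single 2 1)
    rw [h2, ← hu] at h
    simpa [EuclideanSpace.inner_single_right] using h
  have hu3 : u 3 = 0 := by
    have h := A.inner_map_map (EuclideanSpace.single 0 1) (EuclideanSpace.single 3 1)
    rw [h3, ← hu] at h
    simpa [EuclideanSpace.inner_single_right] using h
  have hun : u 0 ^ 2 + u 1 ^ 2 = 1 := by
    have h : ‖u‖ ^ 2 = 1 := by
      rw [hu, LinearIsometryEquiv.norm_map, PiLp.norm_single, norm_one, one_pow]
    rw [EuclideanSpace.norm_sq_eq] at h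
    simpa [Fin.sum_univ_four, hu2, hu3] using h
  obtain ⟨φ, hc, hs⟩ := exists_cos_eq_and_sin_eq_neg hun
  have hρu : (planeRot (d := 3) 0 φ) (EuclideanSpace.single 0 1 : E4) = u := by
    rw [rho_e0, hc, hs, neg_neg]
    ext j
    fin_cases j <;> simp [hu2, hu3]
  -- `B = A` then `(ρ φ)⁻¹` fixes `e₀, e₂, e₃` and maps `e₁` to `±e₁`
  set B : E4 ≃ₗᵢ[ℝ] E4 := A.trans (planeRot (d := 3) 0 φ).symm with hB
  have hB0 : B (EuclideanSpace.single 0 1) = EuclideanSpace.single 0 1 := by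
    rw [hB, LinearIsometryEquiv.trans_apply, ← hu, ← hρu, LinearIsometryEquiv.symm_apply_apply]
  have hB2 : B (EuclideanSpace.single 2 1) = EuclideanSpace.single 2 1 := by
    rw [hB, LinearIsometryEquiv.trans_apply, h2, rho_symm, rho_e2]
  have hB3 : B (EuclideanSpace.single 3 1) = EuclideanSpace.single 3 1 := by
    rw [hB, LinearIsometryEquiv.trans_apply, h3, rho_symm, rho_e3]
  set w : E4 := B (EuclideanSpace.single 1 1) with hw
  have hw0 : w 0 = 0 := by
    have h := B.inner_map_map (EuclideanSpace.single 1 1) (EuclideanSpace.single 0 1)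
    rw [hB0, ← hw] at h
    simpa [EuclideanSpace.inner_single_right] using h
  have hw2 : w 2 = 0 := by
    have h := B.inner_map_map (EuclideanSpace.single 1 1) (EuclideanSpace.single 2 1)
    rw [hB2, ← hw] at h
    simpa [EuclideanSpace.inner_single_right] using h
  have hw3 : w 3 = 0 := by
    have h := B.inner_map_map (EuclideanSpace.single 1 1) (EuclideanSpace.single 3 1)
    rw [hB3, ← hw] at h
    simpa [EuclideanSpace.inner_single_right] using h
  have hw1 : w 1 ^ 2 = 1 := by
    have h : ‖w‖ ^ 2 = 1 := by
      rw [hw, LinearIsometryEquiv.norm_map, PiLp.norm_single, norm_one, one_pow]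
    rw [EuclideanSpace.norm_sq_eq] at h
    simpa [Fin.sum_univ_four, hw0, hw2, hw3] using h
  have hB1 : w = EuclideanSpace.single 1 1 ∨ w = -EuclideanSpace.single 1 1 := by
    have hfac : (w 1 - 1) * (w 1 + 1) = 0 := by linear_combination hw1
    rcases mul_eq_zero.1 hfac with h | h
    · left
      have h' : w 1 = 1 := by linarith
      ext j
      fin_cases j <;> simp [hw0, hw2, hw3, h']
    · right
      have h' : w 1 = -1 := by linarith
      ext j
      fin_cases j <;> simp [hw0, hw2, hw3, h']
  have hBdet : LinearMap.det (B.toLinearEquiv : E4 →ₗ[ℝ] E4) = 1 := by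
    rw [hB, det_trans, hA, det_symm (det_rho φ), one_mul]
  have hPB : P B := hhyper B hBdet fun i => by
    fin_cases i
    exacts [⟨0, Or.inl hB0⟩, ⟨1, hB1⟩, ⟨2, Or.inl hB2⟩, ⟨3, Or.inl hB3⟩]
  have hAB : A = B.trans (planeRot (d := 3) 0 φ) := by
    ext x : 1
    simp [hB]
  rw [hAB]
  exact hmul _ _ hPB (hrho φ)

/-- The closedness hypothesis of `so4_of_cubic_of_sigma5`, stated over axis vectors, is closedness of
`{t | P (ρ t)}`. [folklore] -/
theorem setOf_rot_eq :
    {t : ℝ | ∀ A : E4 ≃ₗᵢ[ℝ] E4,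
      A (EuclideanSpace.single 0 1) =
        Real.cos t • EuclideanSpace.single 0 1 + (-Real.sin t) • EuclideanSpace.single 1 1 →
      A (EuclideanSpace.single 1 1) =
        Real.sin t • EuclideanSpace.single 0 1 + Real.cos t • EuclideanSpace.single 1 1 →
      A (EuclideanSpace.single 2 1) = EuclideanSpace.single 2 1 →
      A (EuclideanSpace.single 3 1) = EuclideanSpace.single 3 1 → P A} =
    {t : ℝ | P (planeRot (d := 3) 0 t)} := by
  ext t
  simp only [Set.mem_setOf_eq]
  constructor
  · intro h
    exact h _ (rho_e0 t) (rho_e1 t) (rho_e2 t) (rho_e3 t)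
  · intro h A h0 h1 h2 h3
    rw [eq_rho_of_apply_single A t h0 h1 h2 h3]
    exact h

/-- **`SO(4)` from the proper signed permutations, the Σ5 rotation and closedness**: a predicate on the
linear isometries of `ℝ⁴` closed under composition and inverses, holding at the identity, closed along the
`(x₀,x₁)`-rotations `ρ t`, holding on every proper signed permutation and on the Σ5 rotation, holds on every
determinant-one isometry. [cite: Niven1956, Cor. 3.12] -/
theorem of_hyper_of_sigma5 (hmul : ∀ A B, P A → P B → P (A.trans B)) (hinv : ∀ A, P A → P A.symm)
    (hone : P (LinearIsometryEquiv.refl ℝ E4)) (hclosed : IsClosed {t : ℝ | P (planeRot (d := 3) 0 t)})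
    (hhyper : ∀ A : E4 ≃ₗᵢ[ℝ] E4, LinearMap.det (A.toLinearEquiv : E4 →ₗ[ℝ] E4) = 1 →
      (∀ i : Fin 4, ∃ j : Fin 4, A (EuclideanSpace.single i 1) = EuclideanSpace.single j 1 ∨
        A (EuclideanSpace.single i 1) = -EuclideanSpace.single j 1) → P A)
    (hsigma : ∀ R : E4 ≃ₗᵢ[ℝ] E4, (R (EuclideanSpace.single 0 1) = EuclideanSpace.single 0 1 ∧
      R (EuclideanSpace.single 1 1) = EuclideanSpace.single 1 1 ∧
      R (EuclideanSpace.single 2 1) =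
        (3 / 5 : ℝ) • EuclideanSpace.single 2 1 + (4 / 5 : ℝ) • EuclideanSpace.single 3 1 ∧
      R (EuclideanSpace.single 3 1) =
        -((4 / 5 : ℝ) • EuclideanSpace.single 2 1) + (3 / 5 : ℝ) • EuclideanSpace.single 3 1) → P R)
    (R : E4 ≃ₗᵢ[ℝ] E4) (hR : LinearMap.det (R.toLinearEquiv : E4 →ₗ[ℝ] E4) = 1) : P R := by
  -- `π/2`: `ρ (π/2)` is a proper signed permutation
  have hpi : P (planeRot (d := 3) 0 (Real.pi / 2)) := hhyper _ (det_rho _) fun i => by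
    fin_cases i
    exacts [⟨1, Or.inr rho_pi_div_two_e0⟩, ⟨0, Or.inl rho_pi_div_two_e1⟩, ⟨2, Or.inl (rho_e2 _)⟩,
      ⟨3, Or.inl (rho_e3 _)⟩]
  -- `θ`: conjugate the Σ5 rotation by `Q_B`
  obtain ⟨θ, hc, hs⟩ := exists_cos_eq_and_sin_eq_neg (a := 3 / 5) (b := 4 / 5) (by norm_num)
  obtain ⟨hQdet, hQ0, hQ1, hQ2, hQ3⟩ := QB_spec
  have hPQ := hhyper _ hQdet fun i => by
    fin_cases i
    exacts [⟨2, Or.inl hQ0⟩, ⟨3, Or.inl hQ1⟩, ⟨0, Or.inl hQ2⟩, ⟨1, Or.inl hQ3⟩]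
  have hθ : P (planeRot (d := 3) 0 θ) := rho_of_conj P hmul hinv hsigma hc hs _ hPQ hQ0 hQ1 hQ2 hQ3
  have hrho : ∀ t, P (planeRot (d := 3) 0 t) :=
    rho_all_of_closed P hmul hinv hone hclosed hpi ⟨θ, hc, hθ⟩
  exact so4_generation P hmul hinv hhyper (planar_of_rho P hmul hhyper hrho) R hR

end Generation

/-- **`SO(4)` from the proper signed permutations, the Σ5 rotation and closedness**, over Mathlib vocabulary
only (the registered sub-goal of stub `stub_upgrade`; this is `of_hyper_of_sigma5` with the closedness
hypothesis stated on axis vectors, `setOf_rot_eq`). [cite: Niven1956, Cor. 3.12] -/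
theorem so4_of_cubic_of_sigma5 : ∀ (P : (EuclideanSpace ℝ (Fin 4) ≃ₗᵢ[ℝ] EuclideanSpace ℝ (Fin 4)) → Prop), (∀ A B, P A → P B → P (A.trans B)) → (∀ A, P A → P A.symm) → P (LinearIsometryEquiv.refl ℝ (EuclideanSpace ℝ (Fin 4))) → IsClosed {t : ℝ | ∀ A : EuclideanSpace ℝ (Fin 4) ≃ₗᵢ[ℝ] EuclideanSpace ℝ (Fin 4), A (EuclideanSpace.single 0 1) = Real.cos t • EuclideanSpace.single 0 1 + (-Real.sin t) • EuclideanSpace.single 1 1 → A (EuclideanSpace.single 1 1) = Real.sin t • EuclideanSpace.single 0 1 + Real.cos t • EuclideanSpace.single 1 1 → A (EuclideanSpace.single 2 1) = EuclideanSpace.single 2 1 → A (EuclideanSpace.single 3 1) = EuclideanSpace.single 3 1 → P A} → (∀ A : EuclideanSpace ℝ (Fin 4) ≃ₗᵢ[ℝ] EuclideanSpace ℝ (Fin 4), LinearMap.det (A.toLinearEquiv : EuclideanSpace ℝ (Fin 4) →ₗ[ℝ] EuclideanSpace ℝ (Fin 4)) = 1 → (∀ i : Fin 4, ∃ j : Fin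 4, A (EuclideanSpace.single i 1) = EuclideanSpace.single j 1 ∨ A (EuclideanSpace.single i 1) = -EuclideanSpace.single j 1) → P A) → (∀ R : EuclideanSpace ℝ (Fin 4) ≃ₗᵢ[ℝ] EuclideanSpace ℝ (Fin 4), (R (EuclideanSpace.single 0 1) = EuclideanSpace.single 0 1 ∧ R (EuclideanSpace.single 1 1) = EuclideanSpace.single 1 1 ∧ R (EuclideanSpace.single 2 1) = (3/5 : ℝ) • EuclideanSpace.single 2 1 + (4/5 : ℝ) • EuclideanSpace.single 3 1 ∧ R (EuclideanSpace.single 3 1) = -((4/5 : ℝ) • EuclideanSpace.single 2 1) + (3/5 : ℝ) • EuclideanSpace.single 3 1) → P R) → ∀ R : EuclideanSpace ℝ (Fin 4) ≃ₗᵢ[ℝ] EuclideanSpace ℝ (Fin 4), LinearMap.det (R.toLinearEquiv : EuclideanSpace ℝ (Fin 4) →ₗ[ℝ] EuclideanSpace ℝ (Fin 4)) = 1 → P R := by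
  intro P hmul hinv hone hclosed hhyper hsigma R hR
  rw [setOf_rot_eq P] at hclosed
  exact of_hyper_of_sigma5 P hmul hinv hone hclosed hhyper hsigma R hR

end Summit.QuantumFields.YangMills.Theorems.OSLegsFromFemtoAndGap.Upgrade

end
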